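import Summits.KontsevichZagierPeriods.KontsevichZagierPeriods.Theses.TorsionLogs
import Summits.KontsevichZagierPeriods.KontsevichZagierPeriods.Theorems.TorsionLogsNeronTorsionSector
import Summits.KontsevichZagierPeriods.KontsevichZagierPeriods.Theorems.TorsionLogsNeronTorsionFlexHeightChain
import Literature.NumberTheory.Transcendental.KZKernelConjectureForms
import Literature.NumberTheory.Transcendental.KZMoveFamily

/-!
# Witness of weakness (F3 / BC5) for the rung `NeronTorsionArcs` — line `NeronTorsionModularArc`
# (crux `TorsionSectorComplete`, stmt-KontsevichZagierPeriods-14212; route `TorsionLogs`, route-KontsevichZagierPeriods-TorsionLogs;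
# forward generator G1 `next-rung`, unit fwd2-rung-KontsevichZagierPeriods-01, gen 16)

The rung `NeronTorsionArcs := ∀ b : Bool, NeronTorsionArcMember b` is graded by the BASE DIMENSION of the
torsion family: member `false` (base dimension 0, ONE algebraic fibre) is the floor decl
`Theses.TorsionLogs.NeronTorsionPrimitiveChain` VERBATIM (`member_false_iff` is `Iff.rfl`), and the seed theorem
`Cruxes.NeronTorsionSector.Translation.stub_assembly : NeronTorsionPrimitiveChain` (item stmt-KontsevichZagierPeriods-17981,
seed g1-KontsevichZagierPeriods-17981, PROVED, 214 lines) closes it BY NAME (`rung_false`, no `sorry`).  Member `true`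
(base dimension 1: a real arc of `Y₁(N)`, fibred representations of dimension 3 and two log boxes of dimension 2,
transcendental fibres) is the new statement `NeronTorsionArcChain`; the floor's proof does not run there (the fibres over
transcendental `t` are not `ℚ`-semialgebraic representations; the chain must be rebuilt on the total spaces): tribunal
forward kernel `floor → rung` open, `real_step = true`.
witness_regime: real Weierstrass pencils over `ℚ̄ ∩ ℝ` with a real `N`-torsion section; Conjecture 1 (the sub-problem
statement) is not known for genus-one iterated integrals in any regime (Huber–Wüstholz 2022, Thm 9.10 is linear in
1-periods; Rem 13.2(3)); the functional shadow is Ayoub 2015, Thm 1.8, which does not give the arithmetic statement.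
Self-contained: verbatim copies of the `def`s of `Lines/NeronTorsionModularArc.lean` in the namespace `…NeronTorsionModularArc.Special`.
-/

noncomputable section

open Set MeasureTheory
open Literature.NumberTheory.Transcendental
open Summit.KontsevichZagierPeriods.KontsevichZagierPeriods.Theses.TorsionLogs
  (NeronTorsionPrimitiveChain TorsionSectorComplete)

set_option linter.dupNamespace false

namespace Summit.KontsevichZagierPeriods.KontsevichZagierPeriods.Cruxes.TorsionSectorComplete.NeronTorsionModularArc.Special

/-! ### Fibre data of the pencil through the 2-torsion abscissa `e₁` -/

/-- The pencil cubic `f_t(x) = 4x³ − t x − (4e₁³ − t e₁) = (x − e₁)(4x² + 4e₁x + 4e₁² − t)`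
(`g₂ = t`, `g₃ = 4e₁³ − t e₁`; every real Weierstrass cubic with largest root `e₁` is a fibre). -/
def pencil (e₁ t x : ℝ) : ℝ := 4 * x ^ 3 - t * x - (4 * e₁ ^ 3 - t * e₁)

/-- Mathlib-normalised model `Y² = X³ − (t/4)X − g₃(t)/4` of the fibre (`y = 2Y`), as in the floor. -/
def fibreCurve (e₁ t : ℝ) : WeierstrassCurve ℝ := ⟨0, 0, 0, -t / 4, -(4 * e₁ ^ 3 - t * e₁) / 4⟩

/-- The fibrewise Néron datum `A_N(t) = |ψ_{N−1}(x_P(t), y_P(t)/2)|` (division value at the torsion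
section; along `Y₁(N)` a modular-unit-type function). -/
def neronUnit (e₁ : ℝ) (N : ℕ) (xP : ℝ → ℝ) (t : ℝ) : ℝ :=
  |((fibreCurve e₁ t).ψ ((N : ℤ) - 1)).evalEval (xP t) (Real.sqrt (pencil e₁ t (xP t)) / 2)|

/-- The fibrewise tangent datum `D(t) = 3e₁² − g₂(t)/4 = f_t′(e₁)/4`. -/
def tangentDatum (e₁ t : ℝ) : ℝ := 3 * e₁ ^ 2 - t / 4

/-- The "log box" integrand `(u, t) ↦ (B(t) − 1)/(1 + u (B(t) − 1))` on `0 < u < 1`: its `u`-integral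
is `log B(t)` for every `B(t) > 0`; `ℚ`-semialgebraic in `(u, t)` when `B` is. -/
def logBox (B : ℝ → ℝ) (w : Fin 2 → ℝ) : ℝ := (B (w 1) - 1) / (1 + w 0 * (B (w 1) - 1))

/-- The box `0 < u < 1`, `t₀ < t < t₁` (coordinates `w 0 = u`, `w 1 = t`). -/
def box (t₀ t₁ : ℝ) : Set (Fin 2 → ℝ) := {w | 0 < w 0 ∧ w 0 < 1 ∧ t₀ < w 1 ∧ w 1 < t₁}

/-! ### The statements -/

/-- Hypotheses on the arc: fixed 2-torsion abscissa `e₁ > 0`, arc `t₀ < t < t₁` of the pencil on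
which `Δ ≠ 0` and `e₁` is the largest root, and a real `N`-torsion section `x_P(t) > e₁` on the
identity component (`N ≥ 3`, `0 < a < N/2`, period relation `N·∫_{x_P(t)}^∞ dx/√f_t = a·ω₁(t)`). -/
def ArcData (e₁ t₀ t₁ : ℝ) (N a : ℕ) (xP : ℝ → ℝ) : Prop :=
  0 < e₁ ∧ t₀ < t₁ ∧ 3 ≤ N ∧ 0 < a ∧ 2 * a < N ∧
  (∀ t ∈ Set.Ioo t₀ t₁, t ^ 3 - 27 * (4 * e₁ ^ 3 - t * e₁) ^ 2 ≠ 0) ∧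
  (∀ t ∈ Set.Ioo t₀ t₁, ∀ x, e₁ < x → 0 < pencil e₁ t x) ∧
  (∀ t ∈ Set.Ioo t₀ t₁, e₁ < xP t) ∧
  (∀ t ∈ Set.Ioo t₀ t₁, ∀ hns : (fibreCurve e₁ t).toAffine.Nonsingular (xP t)
      (Real.sqrt (pencil e₁ t (xP t)) / 2),
    addOrderOf (WeierstrassCurve.Affine.Point.some (xP t) (Real.sqrt (pencil e₁ t (xP t)) / 2) hns) = N) ∧
  (∀ t ∈ Set.Ioo t₀ t₁, (N : ℝ) * (∫ x in Set.Ioi (xP t), (Real.sqrt (pencil e₁ t x))⁻¹) =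
    a * (2 * ∫ x in Set.Ioi e₁, (Real.sqrt (pencil e₁ t x))⁻¹))

/-- The two dimension-3 fibred representations over the arc (parameter `t = z 2` LAST):
`R_I = ∫_{t₀}^{t₁} ∫∫_{e₁<x′<x<x_P(t)} x′ dx′ dx dt/(√f_t(x′)√f_t(x))` (fibre = the floor's `rI`) and
`R_P = ∫_{t₀}^{t₁} ∫∫_{x,x′>e₁} (√f_t(x))⁻¹ (g₂(t)x′+2g₃(t)) dx dx′ dt/(2x′²√f_t(x′))` (fibre = `ω₁η₁/2`). -/
def ArcReps (e₁ t₀ t₁ : ℝ) (xP : ℝ → ℝ) (RI RP : KZ.IntegralRep 3) : Prop :=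
  RI.domain = {z | t₀ < z 2 ∧ z 2 < t₁ ∧ e₁ < z 1 ∧ z 1 < z 0 ∧ z 0 < xP (z 2)} ∧
  Set.EqOn RI.integrand
    (fun z => z 1 / (Real.sqrt (pencil e₁ (z 2) (z 1)) * Real.sqrt (pencil e₁ (z 2) (z 0)))) RI.domain ∧
  RP.domain = {z | t₀ < z 2 ∧ z 2 < t₁ ∧ e₁ < z 0 ∧ e₁ < z 1} ∧
  Set.EqOn RP.integrand
    (fun z => (Real.sqrt (pencil e₁ (z 2) (z 0)))⁻¹ *
      ((z 2 * z 1 + 2 * (4 * e₁ ^ 3 - z 2 * e₁)) / (2 * (z 1) ^ 2 * Real.sqrt (pencil e₁ (z 2) (z 1)))))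
    RP.domain

/-- **Member `true` — the Néron–torsion chain along a modular arc (THE NEW STATEMENT, pinned,
value-free).** For arc data as above and the fibred representations `R_I`, `R_P`, and the two log
boxes `R_ψ = ∫∫ logBox A_N`, `R_D = ∫∫ logBox D` over the arc:
`(N−2)·4N²•[R_I] + (N−2)(N−2a)²•[R_P] − 4N•[R_ψ] + N²(N−2)•[R_D] ∈ KZ.relations`
— the integral over the arc of the fibrewise Néron identity
`(N−2)(4N²·I(P_t) + (N−2a)²·ω₁η₁/2) = 4N·log A_N(t) − N²(N−2)·log D(t)`
(landed fibrewise: `neronTorsion_value_identity`, `neronTorsion_height_chain`). -/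
def NeronTorsionArcChain : Prop :=
  ∀ (e₁ t₀ t₁ : ℝ) (N a : ℕ) (xP : ℝ → ℝ), ArcData e₁ t₀ t₁ N a xP →
    ∀ (RI RP : KZ.IntegralRep 3) (Rψ RD : KZ.IntegralRep 2), ArcReps e₁ t₀ t₁ xP RI RP →
      Rψ.domain = box t₀ t₁ → Set.EqOn Rψ.integrand (logBox (neronUnit e₁ N xP)) Rψ.domain →
      RD.domain = box t₀ t₁ → Set.EqOn RD.integrand (logBox (tangentDatum e₁)) RD.domain →
      (((N : ℤ) - 2) * (4 * (N : ℤ) ^ 2)) • KZ.of RI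
        + (((N : ℤ) - 2) * ((N : ℤ) - 2 * (a : ℤ)) ^ 2) • KZ.of RP
        - (4 * (N : ℤ)) • KZ.of Rψ + ((N : ℤ) ^ 2 * ((N : ℤ) - 2)) • KZ.of RD ∈ KZ.relations

/-- **The family, graded by the base dimension `b` (`false` ↦ b = 0: one fibre — the floor decl
`Theses.TorsionLogs.NeronTorsionPrimitiveChain` VERBATIM; `true` ↦ b = 1: an arc of `Y₁(N)`).** -/
def NeronTorsionArcMember : Bool → Prop
  | false => NeronTorsionPrimitiveChain
  | true => NeronTorsionArcChain

/-- **THE RUNG `NeronTorsionArcs`**: both base dimensions. -/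
def NeronTorsionArcs : Prop := ∀ b : Bool, NeronTorsionArcMember b


/-- Member `false` is the floor decl (definitional). -/
theorem member_false_iff : NeronTorsionArcMember false ↔ NeronTorsionPrimitiveChain := Iff.rfl

/-- **F3 WITNESS: the rung at the floor** — member `false` is the CLOSED seed, by name. -/
theorem rung_false : NeronTorsionArcMember false :=
  Summit.KontsevichZagierPeriods.KontsevichZagierPeriods.Cruxes.NeronTorsionSector.Translation.stub_assembly

/-- The brief's literal shape `example : Rung <floor parameters> := by simpa [Rung] using <seed.theorem>`. -/
example : NeronTorsionArcMember false := by
  rw [member_false_iff]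
  exact Summit.KontsevichZagierPeriods.KontsevichZagierPeriods.Cruxes.NeronTorsionSector.Translation.stub_assembly

/-- The rung is the floor AND the arc member (so the floor is literally its `b = false` instance). -/
theorem neronTorsionArcs_iff : NeronTorsionArcs ↔ NeronTorsionPrimitiveChain ∧ NeronTorsionArcChain := by
  constructor
  · intro h; exact ⟨h false, h true⟩
  · rintro ⟨h₀, h₁⟩ b; cases b
    · exact h₀
    · exact h₁

end Summit.KontsevichZagierPeriods.KontsevichZagierPeriods.Cruxes.TorsionSectorComplete.NeronTorsionModularArc.Special
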